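import Literature.NumberTheory.Sieve.FriedlanderIwaniecPrimesCongrExpSum
import Literature.NumberTheory.Congruences.QuadraticResiduesPrimeSquare
import Mathlib.NumberTheory.LegendreSymbol.JacobiSymbol
import HarnessLib

/-!
# Friedlander–Iwaniec, *The polynomial `X² + Y⁴` captures its primes*, §8: the exact count `N(a; q)` of `a γ₁² ≡ γ₂² (mod q)` — Lemma 8.2, Corollary 8.3, (8.14) and Lemma 8.4 ((8.16))

Family `parity`, statement parity.S17 (`setOf_prime_sq_add_pow_four_infinite`); Line A of the FI
`a² + b⁴` completion (cell `parity-ideate`, ROUND-8 §8 nodes (i)–(ii): the lattice-point main term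
and its Jacobi-kernel form (10.13)). Source: J. Friedlander, H. Iwaniec, Ann. of Math. (2) 148 (1998),
945–1040 = arXiv:math/9811185 [FriedlanderIwaniecAnnals1998], §8, arXiv pp. 27–29: (8.8)–(8.16),
Lemma 8.2, Corollary 8.3, Lemma 8.4. Everything here is PROVED (no named facts, no `sorry`).

The tree (`…CongrExpSum`) has `|Δ| G₀(z₁, z₂) = N(z₂/z₁; |Δ|)` (`gCount_eq`, (8.8)), the twisted
multiplicativity of `S_q(a; h₁, h₂)` (`quadExpSum_mul_of_coprime`, "(8.9) Since `N(a; q)` is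
multiplicative") and the CRUDE bound (8.6) `G₀ ≤ τ(Δ)⁴` (`gCount_le`); "(8.6) … is almost best
possible but in this case we need an exact formula" (p. 28). This file proves the exact formula:

* `quadCongrCount_one_right`, `quadExpSum_zero_zero` — `N(a; q)` of (8.8) is the tree's
  `N(a, 1; q) = quadCongrCount q a 1` ((9.8), `…QuadCongr`) `= S_q(a; 0, 0)`;
  `quadCongrCount_mul_of_coprime` — **(8.9)** multiplicativity (equality; the tree had `≤`).
* The local recursion behind Lemma 8.2 ("One could proceed by counting the solutions to (8.8)
  directly", p. 28 — we do; the source goes through (8.7)): rows `γ₁ = x` through units carry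
  `#{ω : ω² ≡ a (mod p^μ)}` solutions each (`card_row_unit`, via the tree's
  `sum_fibre_eq_sum_sqrtSet`), rows through multiples of `p` reduce to `p² N(a; p^{μ-2})`:
  `quadCongrCount_prime` (`N(a;p) = (p-1)·#sqrt + 1`), `quadCongrCount_prime_pow_add_two`
  (`N(a;p^{μ+2}) = φ(p^{μ+2})·#sqrt + p² N(a;p^μ)`), for every prime `p ∤ a`.
* **LEMMA 8.2, (8.10)** (odd `p ∤ a`): `card_sqrtSet_odd` ((8.12): `#sqrt = 1 + (a/p)`, two roots or
  none — Hardy–Wright §8.4 (3) in the tree, `PrimeSquareResidues.card_sqrts_mod_prime_pow`) and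
  `quadCongrCount_odd_prime_pow` : `N(a; p^ν) = Σ_{i ≤ ν} p^{ν-i} φ(p^i) (a/p)^i`, which is (8.10)
  `p^{-ν} N(a; p^ν) = 1 + (1 - 1/p)([ν/2] + [(ν+1)/2](a/p))` in the summed form of the display after
  (8.12), `[ν/2] + [(ν+1)/2](a/p) = (a/p) + (a/p²) + … + (a/p^ν)`;
  `quadCongrCount_odd_prime_pow_eq_sum_divisors` — the same as `Σ_{d ∣ p^ν} (p^ν/d) φ(d) (a/d)`.
* **LEMMA 8.2, (8.11)** (`p = 2`, `a ≡ 1 (mod 8)`): `card_sqrtSet_two_one` (`= 1`), `card_sqrtSet_two_two`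
  (`= 2`), `card_sqrtSet_two_pow` (`= 4` for `μ ≥ 3`; "`n(a; 2^α) = (4, 2^{α-1})`"; proved by counting
  the squaring map on the odd classes against the tree's `card_sqrtSet_le_four` — a pigeonhole that
  also yields existence) and `quadCongrCount_two_pow` :
  `N(a; 2^ν) = ν 2^ν`, i.e. `2^{-ν} N(a; 2^ν) = ν`.
* **COROLLARY 8.3** `quadCongrCount_eq_sum_divisors` : "For `q` odd and `(a, q) = 1` we have (8.13)
  `N(a; q) = q Σ_{d ∣ q} φ(d)/d (a/d)`" — in integers `N(a; q) = Σ_{d ∣ q} (q/d) φ(d) (a/d)`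
  (`Nat.recOnPosPrimePosCoprime`: prime powers by (8.10), coprime products by (8.9)).
* `quadCongrCount_even` — (8.9) evaluated by (8.11) and (8.13): for `n = 2^ν n'`, `n'` odd, `ν ≥ 1`,
  `a ≡ 1 (mod 8)`, `(a, n) = 1`: `N(a; n) = ν 2^ν Σ_{d ∣ n'} (n'/d) φ(d) (a/d)`;
  `two_mul_sum_divisors_div_four` — the divisor-sum identity (8.14) → (8.16),
  `2 Σ_{d ∣ n/4} φ(d)/d (a/d') = ν Σ_{d ∣ n'} φ(d)/d (a/d)` (`d'` the odd part, convention (8.15);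
  `Σ_{j ≤ ν-2} φ(2^j)/2^j = ν/2`).
* For pairs `z₁, z₂ ∈ ℤ²` with `Δ = det2 z₁ z₂ ≠ 0`, `(Δ, |z₁|²) = (Δ, |z₂|²) = 1` and the rational
  class `a ≡ z₂/z₁ (mod Δ)` ((6.6), the tree's `exists_ratio_mod_det`):
  `gCount_eq_quadCongrCount` (`|Δ| G₀ = N(a, 1; |Δ|)`), `gCount_eq_ord_two_mul_sum` (integer form of
  (8.14)), **(8.14)** `gCount_eq_natAbs_mul_ord_mul_sum` : "`G₀(z₁, z₂) = ν Σ_{d ∣ Δ, d odd} φ(d)/d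
  ((z₂/z₁)/d)` where `ν` is the order of `2` in `Δ`", **LEMMA 8.4 ((8.16))**
  `gCount_eq_natAbs_mul_two_mul_sum` : "`G₀(z₁, z₂) = 2 Σ_{4d ∣ Δ} φ(d)/d ((z₂/z₁)/d)`" with (8.15)
  `(a/d) = (a/d')` — both stated as `|Δ| G₀ = |Δ| · (…)` over `ℚ` with `4d ∣ Δ ⟺ d ∣ |Δ|/4`, under
  `2 ∣ Δ` resp. `4 ∣ Δ` and `a ≡ 1 (mod 8)` ("Note that `z₂/z₁ ≡ 1 (mod 8)` due to (5.7), so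
  `ν ≥ 3`"); `gCount_eq_natAbs_mul_two_mul_sum_of_congr_eight` — Lemma 8.4 under its printed
  hypotheses (`z₁ ≡ z₂ (mod 8)` componentwise, `Re z₁` odd: then `8 ∣ Δ` and `a ≡ 1 (mod 8)`);
  `jacobiSym_ordCompl_eq_of_dvd_sub` — the symbol `(a/d')` depends on `a (mod 4d)` only (so the
  class of `z₂/z₁` modulo `4d`, as in (10.2)/`ratioClass (4d)`, may replace the class modulo `Δ`).

Conventions: pairs `z = (r, s) ∈ ℤ × ℤ`, `Δ(z₁, z₂) = det2 z₁ z₂ = r₁ s₂ - r₂ s₁`, `|z|² = r² + s²`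
(as in `…CongrExpSum`, `…Lemma51`); counts in `0 ≤ x, y < q`; `J(a | b)` Mathlib's Jacobi symbol,
`ordCompl[2] d` the odd part of `d`, `Nat.factorization n 2` the order `ν` of `2` in `n`.

## References

* J. Friedlander, H. Iwaniec, Ann. of Math. (2) 148 (1998), 945–1040, §8: (8.8)–(8.16), Lemma 8.2,
  Corollary 8.3, Lemma 8.4; §6 (6.6), (6.12); §9 (9.8). [FriedlanderIwaniecAnnals1998]
* G. H. Hardy, E. M. Wright, *An Introduction to the Theory of Numbers*, 6th ed. (2008), §8.4 (3)
  (square roots modulo odd prime powers; the tree's `PrimeSquareResidues.card_sqrts_mod_prime_pow`).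
  [HardyWright2008]

## Mathlib / tree search

Tree: `quadCongrCount`, `quadCongrCount_def` (`…QuadCongr`, Lemma 9.1); `quadExpSum`,
`quadExpSum_def`, `quadExpSum_one`, `quadExpSum_mul_of_coprime`, `dvd_quadForm_mod_iff`,
`sum_filter_dvd_range_mul`, `sum_range_mul_shift`, `sqrtSet`, `card_sqrtSet_le_four`,
`sum_fibre_eq_sum_sqrtSet`, `det2`, `gCount`, `gCount_eq`, `isCoprime_ratio` (`…CongrExpSum`);
`Congruences.PrimeSquareResidues.card_sqrts_mod_prime_pow`. Mathlib: `jacobiSym.legendreSym.to_jacobiSym`,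
`legendreSym.eq_one_iff`, `legendreSym.eq_neg_one_iff`, `jacobiSym.sq_one`, `jacobiSym.pow_right`,
`jacobiSym.mul_right'`, `jacobiSym.mod_left'`, `Nat.sum_divisors_prime_pow`, `Nat.divisors_mul`,
`Nat.Coprime.mul_injOn_divisors`, `Nat.recOnPosPrimePosCoprime`, `Nat.totient_prime_pow_succ`,
`Nat.totient_eq_card_coprime`, `Nat.ordProj_mul_ordCompl_eq_self`, `Nat.ordCompl_mul`,
`Nat.ordCompl_self_pow`, `Nat.coprime_ordCompl`, `Nat.not_dvd_ordCompl`,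
`Nat.Prime.pow_dvd_iff_le_factorization`, `Finset.card_eq_sum_card_fiberwise`,
`Finset.sum_eq_sum_iff_of_le`, `Nat.twoStepInduction`, `Int.prime_two`, `Prime.coprime_iff_not_dvd`.
-/

noncomputable section

open Finset
open scoped NumberTheorySymbols Nat

namespace Literature.NumberTheory.Sieve.FriedlanderIwaniecPrimes

/-! ### `N(a; q)` and its elementary properties -/

/-- `N(a; q)` of (8.8) — the number of pairs of classes `γ₁, γ₂ (mod q)` with
`a γ₁² ≡ γ₂² (mod q)`, `|Δ| G₀(z₁, z₂) = N(z₂/z₁; |Δ|)` ((6.12), (8.8); the tree's `gCount`,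
`gCount_eq`) — is the tree's `N(a, 1; q) = quadCongrCount q a 1` of (9.8) (Lemma 9.1 file).
[cite: FriedlanderIwaniecAnnals1998, (8.8), (9.8)] -/
theorem quadCongrCount_one_right (q : ℕ) (a : ℤ) :
    quadCongrCount q a 1 =
      #(((range q) ×ˢ (range q)).filter
        fun γ : ℕ × ℕ => (q : ℤ) ∣ a * (γ.1 : ℤ) ^ 2 - (γ.2 : ℤ) ^ 2) := by
  rw [quadCongrCount_def]
  congr 1
  exact filter_congr fun γ _ => by rw [one_mul]

/-- `N(a; q) = Σ_{x (mod q)} #{y (mod q) : a x² ≡ y²}` (the rows `γ₁ = x` of (8.8)).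
[cite: FriedlanderIwaniecAnnals1998, (8.8)] -/
private theorem quadCongrCount_one_right_eq_sum (q : ℕ) (a : ℤ) :
    quadCongrCount q a 1 =
      ∑ x ∈ range q, #((range q).filter fun y : ℕ => (q : ℤ) ∣ a * (x : ℤ) ^ 2 - (y : ℤ) ^ 2) := by
  rw [quadCongrCount_one_right]
  simp only [card_filter, sum_product]

/-- `S_q(a; 0, 0) = N(a; q)`: the exponential sum (6.10)/(8.3) of the tree at the zero frequency is the
count (8.8). [cite: FriedlanderIwaniecAnnals1998, (6.12), (8.8)] -/
theorem quadExpSum_zero_zero (q : ℕ) (a : ℤ) : quadExpSum q a 0 0 = (quadCongrCount q a 1 : ℂ) := by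
  rw [quadExpSum_def, quadCongrCount_one_right, card_filter, Nat.cast_sum, sum_product]
  refine sum_congr rfl fun x _ => sum_congr rfl fun y _ => ?_
  split_ifs <;> simp

/-- `N(a; 1) = 1`. [cite: FriedlanderIwaniecAnnals1998, (8.9)] -/
theorem quadCongrCount_mod_one (a : ℤ) : quadCongrCount 1 a 1 = 1 := by
  have h := quadExpSum_zero_zero 1 a
  rw [quadExpSum_one] at h
  exact_mod_cast h.symm

/-- **"Since `N(a; q)` is multiplicative"** ((8.9)): `N(a; mn) = N(a; m) N(a; n)` for coprime `m, n`
(the tree's `quadCongrCount_mul_le` is the injectivity half; equality via the twisted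
multiplicativity `quadExpSum_mul_of_coprime` at the zero frequency).
[cite: FriedlanderIwaniecAnnals1998, (8.9)] -/
theorem quadCongrCount_mul_of_coprime {m n : ℕ} (hm : 0 < m) (hn : 0 < n) (hmn : m.Coprime n)
    (a : ℤ) : quadCongrCount (m * n) a 1 = quadCongrCount m a 1 * quadCongrCount n a 1 := by
  obtain ⟨u, v, huv⟩ := (Nat.isCoprime_iff_coprime.mpr hmn : IsCoprime (m : ℤ) (n : ℤ))
  have h := quadExpSum_mul_of_coprime hm hn hmn huv a 0 0
  simp only [mul_zero, quadExpSum_zero_zero] at h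
  exact_mod_cast h

/-- The row count depends on `x (mod q)` only. [folklore] -/
private theorem card_row_mod {q : ℕ} (hq : 0 < q) (a : ℤ) (x : ℕ) :
    #((range q).filter fun y : ℕ => (q : ℤ) ∣ a * ((x % q : ℕ) : ℤ) ^ 2 - (y : ℤ) ^ 2) =
      #((range q).filter fun y : ℕ => (q : ℤ) ∣ a * (x : ℤ) ^ 2 - (y : ℤ) ^ 2) := by
  congr 1
  refine filter_congr fun y hy => ?_
  have h := dvd_quadForm_mod_iff hq a x y (dvd_refl q)
  rw [Nat.mod_eq_of_lt (mem_range.mp hy)] at h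
  exact h

/-- A `q`-periodic function summed over `q k` consecutive integers. [folklore] -/
private theorem sum_range_mul_of_mod_periodic {M : Type*} [AddCommMonoid M] (q k : ℕ) (f : ℕ → M)
    (hf : ∀ x, f (x % q) = f x) : ∑ x ∈ range (q * k), f x = k • ∑ x ∈ range q, f x := by
  rw [sum_range_mul_shift q k]
  rw [sum_congr rfl fun s _ => sum_congr rfl fun x₀ _ =>
    show f (x₀ + q * s) = f x₀ by rw [← hf (x₀ + q * s), Nat.add_mul_mod_self_left, hf],
    sum_const, card_range]

/-! ### The local recursion: rows through units and rows through multiples of `p` -/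

section Local

variable {p : ℕ} (hp : p.Prime)
include hp

/-- **Rows through units.** For `p ∤ a`, `p ∤ x`, `μ ≥ 1`: the classes `y (mod p^μ)` with
`a x² ≡ y²` are the `ω x`, `ω² ≡ a` — so there are exactly `#{ω (mod p^μ) : ω² ≡ a}` of them (the
count behind (8.10)–(8.12): "for each `γ₂` … the congruence `γ₁² ≡ r (mod q)`").
[cite: FriedlanderIwaniecAnnals1998, Lemma 8.2 (proof), (8.12)] -/
theorem card_row_unit {μ : ℕ} (hμ : 0 < μ) {a : ℤ} (ha : ¬ (p : ℤ) ∣ a) {x : ℕ} (hx : ¬ p ∣ x) :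
    #((range (p ^ μ)).filter fun y : ℕ => ((p ^ μ : ℕ) : ℤ) ∣ a * (x : ℤ) ^ 2 - (y : ℤ) ^ 2) =
      #(sqrtSet p μ a) := by
  have hpp : Prime (p : ℤ) := Nat.prime_iff_prime_int.mp hp
  have hpq : (p : ℤ) ∣ ((p ^ μ : ℕ) : ℤ) := by exact_mod_cast dvd_pow_self p hμ.ne'
  -- only units `y` contribute
  have h1 : (range (p ^ μ)).filter (fun y : ℕ => ((p ^ μ : ℕ) : ℤ) ∣ a * (x : ℤ) ^ 2 - (y : ℤ) ^ 2) =
      ((range (p ^ μ)).filter (fun y => ¬ p ∣ y)).filter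
        (fun y : ℕ => ((p ^ μ : ℕ) : ℤ) ∣ a * (x : ℤ) ^ 2 - (y : ℤ) ^ 2) := by
    rw [filter_filter]
    refine filter_congr fun y _ => ⟨fun h => ⟨?_, h⟩, fun h => h.2⟩
    intro hpy
    have h2 : (p : ℤ) ∣ a * (x : ℤ) ^ 2 - (y : ℤ) ^ 2 := hpq.trans h
    have h3 : (p : ℤ) ∣ (y : ℤ) ^ 2 := Dvd.dvd.pow (Int.natCast_dvd_natCast.mpr hpy) two_ne_zero
    have h4 : (p : ℤ) ∣ a * (x : ℤ) ^ 2 := by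
      have := dvd_add h2 h3
      simpa using this
    rcases hpp.dvd_or_dvd h4 with h5 | h5
    · exact ha h5
    · exact hx (Int.natCast_dvd_natCast.mp (hpp.dvd_of_dvd_pow h5))
  have h2 := sum_fibre_eq_sum_sqrtSet hp hμ ha hx (fun _ => (1 : ℂ))
  rw [sum_boole, sum_const, nsmul_eq_mul, mul_one] at h2
  rw [h1]
  exact_mod_cast h2

/-- The units modulo `p^μ`, `μ ≥ 1`, counted in `0 ≤ x < p^μ`: `φ(p^μ)` of them. [folklore] -/
private theorem card_filter_not_dvd {μ : ℕ} (hμ : 0 < μ) :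
    #((range (p ^ μ)).filter fun x => ¬ p ∣ x) = (p ^ μ).totient := by
  rw [Nat.totient_eq_card_coprime]
  congr 1
  exact filter_congr fun x _ => by rw [Nat.coprime_pow_left_iff hμ, hp.coprime_iff_not_dvd]

/-- **Rows through units, summed**: `Σ_{x unit (mod p^μ)} #{y : a x² ≡ y²} = φ(p^μ) · #{ω : ω² ≡ a}`.
[cite: FriedlanderIwaniecAnnals1998, Lemma 8.2 (proof)] -/
private theorem sum_row_unit {μ : ℕ} (hμ : 0 < μ) {a : ℤ} (ha : ¬ (p : ℤ) ∣ a) :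
    ∑ x ∈ (range (p ^ μ)).filter (fun x => ¬ p ∣ x),
      #((range (p ^ μ)).filter fun y : ℕ => ((p ^ μ : ℕ) : ℤ) ∣ a * (x : ℤ) ^ 2 - (y : ℤ) ^ 2) =
      (p ^ μ).totient * #(sqrtSet p μ a) := by
  rw [sum_congr rfl fun x hx => card_row_unit hp hμ ha (mem_filter.mp hx).2, sum_const, smul_eq_mul,
    card_filter_not_dvd hp hμ]

/-- **Rows through multiples of `p`, `q = p`**: only `x = y = 0`. [cite: FriedlanderIwaniecAnnals1998, Lemma 8.2 (proof)] -/
private theorem sum_row_dvd_one (a : ℤ) :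
    ∑ x ∈ (range (p ^ 1)).filter (fun x => p ∣ x),
      #((range (p ^ 1)).filter fun y : ℕ => ((p ^ 1 : ℕ) : ℤ) ∣ a * (x : ℤ) ^ 2 - (y : ℤ) ^ 2) = 1 := by
  have hpp : Prime (p : ℤ) := Nat.prime_iff_prime_int.mp hp
  have hfilt : (range (p ^ 1)).filter (fun x => p ∣ x) = {0} := by
    ext x
    simp only [mem_filter, mem_range, mem_singleton, pow_one]
    constructor
    · rintro ⟨hx, hdx⟩
      exact Nat.eq_zero_of_dvd_of_lt hdx hx
    · rintro rfl
      exact ⟨hp.pos, dvd_zero _⟩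
  have hrow : ((range (p ^ 1)).filter fun y : ℕ => ((p ^ 1 : ℕ) : ℤ) ∣ a * ((0 : ℕ) : ℤ) ^ 2 - (y : ℤ) ^ 2) = {0} := by
    ext y
    simp only [mem_filter, mem_range, mem_singleton, pow_one, Nat.cast_zero]
    constructor
    · rintro ⟨hy, hd⟩
      have hd' : (p : ℤ) ∣ (y : ℤ) ^ 2 := by
        have : (p : ℤ) ∣ -(a * (0 : ℤ) ^ 2 - (y : ℤ) ^ 2) := (dvd_neg).mpr hd
        simpa using this
      exact Nat.eq_zero_of_dvd_of_lt (Int.natCast_dvd_natCast.mp (hpp.dvd_of_dvd_pow hd')) hy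
    · rintro rfl
      exact ⟨hp.pos, by simp⟩
  rw [hfilt, sum_singleton, hrow, card_singleton]

/-- **Rows through multiples of `p`, `q = p^{μ+2}`**: `x = p x'`, `y = p y'` and the congruence drops
to `p^μ`: the contribution is `p² N(a; p^μ)` ("we reduce to the case `q = p^{ν-2}` by dividing
through by `p²`", proof of Lemma 9.1; here exactly). [cite: FriedlanderIwaniecAnnals1998, Lemma 8.2 (proof), Lemma 9.1 (proof)] -/
private theorem sum_row_dvd_add_two (μ : ℕ) (a : ℤ) :
    ∑ x ∈ (range (p ^ (μ + 2))).filter (fun x => p ∣ x),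
      #((range (p ^ (μ + 2))).filter fun y : ℕ => ((p ^ (μ + 2) : ℕ) : ℤ) ∣ a * (x : ℤ) ^ 2 - (y : ℤ) ^ 2) =
      p ^ 2 * quadCongrCount (p ^ μ) a 1 := by
  have hpp : Prime (p : ℤ) := Nat.prime_iff_prime_int.mp hp
  have hp0 : 0 < p := hp.pos
  have hpμ : 0 < p ^ μ := pow_pos hp0 μ
  have hpq : (p : ℤ) ∣ ((p ^ (μ + 2) : ℕ) : ℤ) := by
    exact_mod_cast dvd_pow_self p (by omega : μ + 2 ≠ 0)
  -- (1) for `p ∣ x` only `p ∣ y` contribute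
  have hrow : ∀ x, p ∣ x → #((range (p ^ (μ + 2))).filter fun y : ℕ => ((p ^ (μ + 2) : ℕ) : ℤ) ∣ a * (x : ℤ) ^ 2 - (y : ℤ) ^ 2) =
      ∑ y ∈ (range (p ^ (μ + 2))).filter (fun y => p ∣ y),
        if ((p ^ (μ + 2) : ℕ) : ℤ) ∣ a * (x : ℤ) ^ 2 - ((y : ℕ) : ℤ) ^ 2 then 1 else 0 := by
    intro x hx
    rw [card_filter]
    symm
    apply sum_filter_of_ne
    intro y _ hne
    have hP : ((p ^ (μ + 2) : ℕ) : ℤ) ∣ a * (x : ℤ) ^ 2 - (y : ℤ) ^ 2 := by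
      by_contra h
      exact hne (if_neg h)
    have h1 : (p : ℤ) ∣ a * (x : ℤ) ^ 2 :=
      Dvd.dvd.mul_left (Dvd.dvd.pow (Int.natCast_dvd_natCast.mpr hx) two_ne_zero) a
    have h2 : (p : ℤ) ∣ (y : ℤ) ^ 2 := by
      have := dvd_sub h1 (hpq.trans hP)
      simpa using this
    exact Int.natCast_dvd_natCast.mp (hpp.dvd_of_dvd_pow h2)
  -- (2) substitute `x = p x'`, `y = p y'` and divide the congruence by `p²`
  have hq : p ^ (μ + 2) = p * p ^ (μ + 1) := by ring
  have hiff : ∀ x y : ℕ, ((p ^ (μ + 2) : ℕ) : ℤ) ∣ a * ((p * x : ℕ) : ℤ) ^ 2 - ((p * y : ℕ) : ℤ) ^ 2 ↔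
      ((p ^ μ : ℕ) : ℤ) ∣ a * (x : ℤ) ^ 2 - (y : ℤ) ^ 2 := by
    intro x y
    have e1 : ((p ^ (μ + 2) : ℕ) : ℤ) = (p : ℤ) ^ 2 * ((p ^ μ : ℕ) : ℤ) := by push_cast; ring
    have e2 : a * ((p * x : ℕ) : ℤ) ^ 2 - ((p * y : ℕ) : ℤ) ^ 2 =
        (p : ℤ) ^ 2 * (a * (x : ℤ) ^ 2 - (y : ℤ) ^ 2) := by push_cast; ring
    rw [e1, e2]
    exact mul_dvd_mul_iff_left (pow_ne_zero 2 (by exact_mod_cast hp.ne_zero))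
  -- the function of `(x', y')` after the substitution, `p^μ`-periodic in each variable
  set g : ℕ → ℕ → ℕ := fun x y =>
    if ((p ^ μ : ℕ) : ℤ) ∣ a * (x : ℤ) ^ 2 - (y : ℤ) ^ 2 then 1 else 0 with hg
  have hgy : ∀ x y, g x (y % p ^ μ) = g x y := by
    intro x y
    have h := (dvd_quadForm_mod_iff hpμ a x y (dvd_refl _)).symm
    have h' := dvd_quadForm_mod_iff hpμ a x (y % p ^ μ) (dvd_refl _)
    rw [Nat.mod_mod] at h'
    simp only [hg]
    by_cases hc : ((p ^ μ : ℕ) : ℤ) ∣ a * (x : ℤ) ^ 2 - (y : ℤ) ^ 2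
    · rw [if_pos hc, if_pos (h'.mp (h.mp hc))]
    · rw [if_neg hc, if_neg (fun h'' => hc (h.mpr (h'.mpr h'')))]
  have hgsum : ∀ x, ∑ y ∈ range (p ^ μ), g x y = #((range (p ^ μ)).filter fun y : ℕ => ((p ^ μ : ℕ) : ℤ) ∣ a * (x : ℤ) ^ 2 - (y : ℤ) ^ 2) := by
    intro x
    rw [card_filter]
  calc ∑ x ∈ (range (p ^ (μ + 2))).filter (fun x => p ∣ x),
        #((range (p ^ (μ + 2))).filter fun y : ℕ => ((p ^ (μ + 2) : ℕ) : ℤ) ∣ a * (x : ℤ) ^ 2 - (y : ℤ) ^ 2)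
      = ∑ x ∈ (range (p * p ^ (μ + 1))).filter (fun x => p ∣ x),
          ∑ y ∈ (range (p * p ^ (μ + 1))).filter (fun y => p ∣ y),
            if ((p ^ (μ + 2) : ℕ) : ℤ) ∣ a * (x : ℤ) ^ 2 - ((y : ℕ) : ℤ) ^ 2 then 1 else 0 := by
        rw [← hq]
        exact sum_congr rfl fun x hx => hrow x (mem_filter.mp hx).2
    _ = ∑ x ∈ range (p ^ (μ + 1)), ∑ y ∈ range (p ^ (μ + 1)), g x y := by
        rw [sum_filter_dvd_range_mul hp0]
        refine sum_congr rfl fun x _ => ?_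
        rw [sum_filter_dvd_range_mul hp0]
        refine sum_congr rfl fun y _ => ?_
        simp only [hg]
        by_cases hc : ((p ^ μ : ℕ) : ℤ) ∣ a * (x : ℤ) ^ 2 - (y : ℤ) ^ 2
        · rw [if_pos hc, if_pos ((hiff x y).mpr hc)]
        · rw [if_neg hc, if_neg (fun h => hc ((hiff x y).mp h))]
    _ = ∑ x ∈ range (p ^ (μ + 1)), p * #((range (p ^ μ)).filter fun y : ℕ => ((p ^ μ : ℕ) : ℤ) ∣ a * (x : ℤ) ^ 2 - (y : ℤ) ^ 2) := by
        refine sum_congr rfl fun x _ => ?_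
        rw [pow_succ, sum_range_mul_of_mod_periodic (p ^ μ) p (g x) (hgy x), hgsum, smul_eq_mul]
    _ = p * ∑ x ∈ range (p ^ μ), p * #((range (p ^ μ)).filter fun y : ℕ => ((p ^ μ : ℕ) : ℤ) ∣ a * (x : ℤ) ^ 2 - (y : ℤ) ^ 2) := by
        rw [pow_succ, sum_range_mul_of_mod_periodic (p ^ μ) p
          (fun x => p * #((range (p ^ μ)).filter fun y : ℕ => ((p ^ μ : ℕ) : ℤ) ∣ a * (x : ℤ) ^ 2 - (y : ℤ) ^ 2))
          (fun x => by simp only [card_row_mod hpμ]), smul_eq_mul]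
    _ = p ^ 2 * quadCongrCount (p ^ μ) a 1 := by
        rw [quadCongrCount_one_right_eq_sum, mul_sum, mul_sum]
        refine sum_congr rfl fun x _ => ?_
        ring

/-- **The local recursion, first floor**: `N(a; p) = (p − 1) · #{ω (mod p) : ω² ≡ a} + 1` for `p ∤ a`.
[cite: FriedlanderIwaniecAnnals1998, Lemma 8.2 (proof)] -/
theorem quadCongrCount_prime {a : ℤ} (ha : ¬ (p : ℤ) ∣ a) :
    quadCongrCount (p ^ 1) a 1 = (p ^ 1).totient * #(sqrtSet p 1 a) + 1 := by
  rw [quadCongrCount_one_right_eq_sum, ← sum_filter_add_sum_filter_not (range (p ^ 1)) (fun x => p ∣ x),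
    sum_row_dvd_one hp, sum_row_unit hp one_pos ha, add_comm]

/-- **The local recursion, two floors up**: `N(a; p^{μ+2}) = φ(p^{μ+2}) · #{ω (mod p^{μ+2}) : ω² ≡ a} + p² N(a; p^μ)`
for `p ∤ a`. [cite: FriedlanderIwaniecAnnals1998, Lemma 8.2 (proof)] -/
theorem quadCongrCount_prime_pow_add_two {a : ℤ} (ha : ¬ (p : ℤ) ∣ a) (μ : ℕ) :
    quadCongrCount (p ^ (μ + 2)) a 1 =
      (p ^ (μ + 2)).totient * #(sqrtSet p (μ + 2) a) + p ^ 2 * quadCongrCount (p ^ μ) a 1 := by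
  rw [quadCongrCount_one_right_eq_sum, ← sum_filter_add_sum_filter_not (range (p ^ (μ + 2))) (fun x => p ∣ x),
    sum_row_dvd_add_two hp, sum_row_unit hp (by omega) ha, add_comm]

/-! ### Lemma 8.2, odd `p`: (8.10) and Corollary 8.3 at prime powers -/

/-- For an odd prime `p ∤ a` and `μ ≥ 1`: `#{ω (mod p^μ) : ω² ≡ a} = 1 + (a/p)` ((8.12), "two roots or
none"; Hardy–Wright §8.4 (3) in the tree). [cite: FriedlanderIwaniecAnnals1998, (8.12)] -/
theorem card_sqrtSet_odd (hp2 : p ≠ 2) {a : ℤ} (ha : ¬ (p : ℤ) ∣ a) {μ : ℕ} (hμ : 0 < μ) :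
    (#(sqrtSet p μ a) : ℤ) = 1 + J(a | p) := by
  haveI := Fact.mk hp
  have h := Congruences.PrimeSquareResidues.card_sqrts_mod_prime_pow (p := p) hp2 ha (Nat.one_le_iff_ne_zero.mpr hμ.ne')
  have hset : sqrtSet p μ a = (range (p ^ μ)).filter (fun x : ℕ => (p : ℤ) ^ μ ∣ ((x : ℕ) : ℤ) ^ 2 - a) := by
    unfold sqrtSet
    refine filter_congr fun x _ => ?_
    push_cast
    exact Iff.rfl
  rw [hset, h, ← jacobiSym.legendreSym.to_jacobiSym]
  have ha0 : (a : ZMod p) ≠ 0 := by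
    rwa [Ne, ZMod.intCast_zmod_eq_zero_iff_dvd]
  split_ifs with hs
  · rw [(legendreSym.eq_one_iff p ha0).mpr hs]; norm_num
  · rw [(legendreSym.eq_neg_one_iff p).mpr hs]; norm_num

/-- `(a/p)² = 1` for `p ∤ a`. [folklore] -/
private theorem jacobiSym_sq_eq_one {a : ℤ} (ha : ¬ (p : ℤ) ∣ a) : J(a | p) ^ 2 = 1 := by
  apply jacobiSym.sq_one
  rw [Int.gcd_eq_natAbs, Int.natAbs_natCast]
  exact Nat.coprime_comm.mp ((hp.coprime_iff_not_dvd).mpr fun h => ha (Int.natCast_dvd.mpr h))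

omit hp in
/-- `χ^k (1 + χ) = 1 + χ` when `χ² = 1`. [folklore] -/
private theorem pow_mul_one_add {χ : ℤ} (hχ : χ ^ 2 = 1) (k : ℕ) : χ ^ k * (1 + χ) = 1 + χ := by
  induction k with
  | zero => simp
  | succ k ih =>
    calc χ ^ (k + 1) * (1 + χ) = χ ^ k * (χ + χ ^ 2) := by ring
      _ = χ ^ k * (1 + χ) := by rw [hχ, add_comm]
      _ = 1 + χ := ih

/-- **Lemma 8.2, (8.10)** (odd `p ∤ a`), in the summed form of the display after (8.12):
`N(a; p^μ) = Σ_{0 ≤ i ≤ μ} p^{μ-i} φ(p^i) (a/p)^i`, i.e.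
`p^{-ν} N(a; p^ν) = 1 + (1 - 1/p)([ν/2] + [(ν+1)/2](a/p)) = Σ_{i ≤ ν} φ(p^i)/p^i (a/p^i)`.
The source derives it from (8.7); here by the direct recursion on `ν` (rows through units /
through multiples of `p`), which the source mentions as the alternative ("One could proceed by
counting the solutions to (8.8) directly"). [cite: FriedlanderIwaniecAnnals1998, Lemma 8.2, (8.10)] -/
theorem quadCongrCount_odd_prime_pow (hp2 : p ≠ 2) {a : ℤ} (ha : ¬ (p : ℤ) ∣ a) (μ : ℕ) :
    (quadCongrCount (p ^ μ) a 1 : ℤ) =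
      ∑ i ∈ range (μ + 1), (p : ℤ) ^ (μ - i) * ((p ^ i).totient : ℤ) * J(a | p) ^ i := by
  have hχ := jacobiSym_sq_eq_one hp ha
  have hp1 : ((p - 1 : ℕ) : ℤ) = (p : ℤ) - 1 := Nat.cast_pred hp.pos
  induction μ using Nat.twoStepInduction with
  | zero =>
    simp [quadCongrCount_mod_one]
  | one =>
    rw [quadCongrCount_prime hp ha, Nat.cast_add, Nat.cast_mul, card_sqrtSet_odd hp hp2 ha one_pos,
      sum_range_succ, sum_range_succ, sum_range_zero, pow_one, Nat.totient_prime hp, hp1]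
    simp
    ring
  | more μ ih _ =>
    rw [quadCongrCount_prime_pow_add_two hp ha μ, Nat.cast_add, Nat.cast_mul, Nat.cast_mul,
      card_sqrtSet_odd hp hp2 ha (by omega), ih, sum_range_succ _ (μ + 2), sum_range_succ _ (μ + 1)]
    have hφ2 : (((p ^ (μ + 2)).totient : ℕ) : ℤ) = (p : ℤ) ^ (μ + 1) * ((p : ℤ) - 1) := by
      rw [show μ + 2 = μ + 1 + 1 by rfl, Nat.totient_prime_pow_succ hp, Nat.cast_mul, hp1]
      push_cast; ring
    have hφ1 : (((p ^ (μ + 1)).totient : ℕ) : ℤ) = (p : ℤ) ^ μ * ((p : ℤ) - 1) := by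
      rw [Nat.totient_prime_pow_succ hp, Nat.cast_mul, hp1]
      push_cast; ring
    have hsum : ∑ i ∈ range (μ + 1), (p : ℤ) ^ (μ + 2 - i) * ((p ^ i).totient : ℤ) * J(a | p) ^ i =
        (p : ℤ) ^ 2 * ∑ i ∈ range (μ + 1), (p : ℤ) ^ (μ - i) * ((p ^ i).totient : ℤ) * J(a | p) ^ i := by
      rw [mul_sum]
      refine sum_congr rfl fun i hi => ?_
      have hi' : i ≤ μ := Nat.lt_succ_iff.mp (mem_range.mp hi)
      rw [show μ + 2 - i = μ - i + 2 by omega, pow_add]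
      ring
    rw [hsum, hφ2, hφ1, Nat.cast_pow, show μ + 2 - (μ + 1) = 1 by omega,
      show μ + 2 - (μ + 2) = 0 by omega, pow_one, pow_zero, one_mul]
    have key : (p : ℤ) * ((p : ℤ) ^ μ * ((p : ℤ) - 1)) * J(a | p) ^ (μ + 1) +
        (p : ℤ) ^ (μ + 1) * ((p : ℤ) - 1) * J(a | p) ^ (μ + 2) =
        (p : ℤ) ^ (μ + 1) * ((p : ℤ) - 1) * (1 + J(a | p)) := by
      calc _ = (p : ℤ) ^ (μ + 1) * ((p : ℤ) - 1) * (J(a | p) ^ (μ + 1) * (1 + J(a | p))) := by ring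
        _ = _ := by rw [pow_mul_one_add hχ]
    linear_combination (-1 : ℤ) * key

/-- **Corollary 8.3 at a prime power**: for odd `p ∤ a`,
`N(a; p^μ) = p^μ Σ_{d ∣ p^μ} φ(d)/d (a/d)`, in integers `= Σ_{d ∣ p^μ} (p^μ/d) φ(d) (a/d)`.
[cite: FriedlanderIwaniecAnnals1998, Corollary 8.3, (8.13)] -/
theorem quadCongrCount_odd_prime_pow_eq_sum_divisors (hp2 : p ≠ 2) {a : ℤ} (ha : ¬ (p : ℤ) ∣ a)
    (μ : ℕ) : (quadCongrCount (p ^ μ) a 1 : ℤ) =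
      ∑ d ∈ (p ^ μ).divisors, ((p ^ μ / d : ℕ) : ℤ) * (d.totient : ℤ) * J(a | d) := by
  rw [quadCongrCount_odd_prime_pow hp hp2 ha, Nat.sum_divisors_prime_pow hp]
  refine sum_congr rfl fun i hi => ?_
  rw [Nat.pow_div (Nat.lt_succ_iff.mp (mem_range.mp hi)) hp.pos, jacobiSym.pow_right, Nat.cast_pow]

end Local

/-! ### Lemma 8.2, `p = 2`: (8.11) -/

/-- Square roots modulo `2`: for odd `a`, only `ω = 1`. [cite: FriedlanderIwaniecAnnals1998, Lemma 8.2 (proof, `n(a; 2^α) = (4, 2^{α-1})`)] -/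
theorem card_sqrtSet_two_one {a : ℤ} (ha : a % 8 = 1) : #(sqrtSet 2 1 a) = 1 := by
  have hset : sqrtSet 2 1 a = {1} := by
    ext y
    simp only [sqrtSet, mem_filter, mem_range, mem_singleton, pow_one, Nat.cast_ofNat]
    constructor
    · rintro ⟨hy, hd⟩
      interval_cases y
      · exfalso
        norm_num at hd
        omega
      · rfl
    · rintro rfl
      refine ⟨by norm_num, ?_⟩
      norm_num
      omega
  rw [hset, card_singleton]

/-- Square roots modulo `4`: for `a ≡ 1 (mod 4)`, exactly `ω = 1, 3`. [cite: FriedlanderIwaniecAnnals1998, Lemma 8.2 (proof, `n(a; 2^α) = (4, 2^{α-1})`)] -/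
theorem card_sqrtSet_two_two {a : ℤ} (ha : a % 8 = 1) : #(sqrtSet 2 2 a) = 2 := by
  have hset : sqrtSet 2 2 a = {1, 3} := by
    ext y
    simp only [sqrtSet, mem_filter, mem_range, mem_insert, mem_singleton]
    constructor
    · rintro ⟨hy, hd⟩
      norm_num at hd
      interval_cases y
      · exfalso; norm_num at hd; omega
      · exact Or.inl rfl
      · exfalso; norm_num at hd; omega
      · exact Or.inr rfl
    · rintro (rfl | rfl)
      · refine ⟨by norm_num, ?_⟩
        norm_num
        omega
      · refine ⟨by norm_num, ?_⟩
        norm_num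
        omega
  rw [hset]
  decide

/-- **Square roots modulo `2^μ`, `μ ≥ 3`**: for `c ≡ 1 (mod 8)` there are exactly four
(`n(a; 2^α) = (4, 2^{α-1})` in the proof of Lemma 8.2). Proof by counting: the `2^{μ-1}` odd classes
square into the `2^{μ-3}` classes `≡ 1 (mod 8)`, each of which has at most four square roots
(the tree's `card_sqrtSet_le_four`), hence exactly four.
[cite: FriedlanderIwaniecAnnals1998, Lemma 8.2 (proof, `n(a; 2^α) = (4, 2^{α-1})`)] -/
theorem card_sqrtSet_two_pow {c : ℤ} (hc : c % 8 = 1) {μ : ℕ} (hμ : 3 ≤ μ) :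
    #(sqrtSet 2 μ c) = 4 := by
  obtain ⟨m, rfl⟩ : ∃ m, μ = m + 3 := ⟨μ - 3, by omega⟩
  set q : ℕ := 2 ^ (m + 3) with hq
  have hq8 : q = 8 * 2 ^ m := by rw [hq]; ring
  have hq8' : 8 ∣ q := ⟨2 ^ m, hq8⟩
  have hq0 : 0 < q := by positivity
  -- the odd classes and the classes `≡ 1 (mod 8)`
  set U : Finset ℕ := (range q).filter (fun y => ¬ 2 ∣ y) with hU
  set C : Finset ℕ := (range q).filter (fun r => r % 8 = 1) with hC
  have hUcard : #U = 4 * 2 ^ m := by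
    have h1 : #((range q).filter (fun y => 2 ∣ y)) + #U = #(range q) :=
      card_filter_add_card_filter_not _
    have h2 : #((range q).filter (fun y => 2 ∣ y)) = 4 * 2 ^ m := by
      rw [show q = 2 * (4 * 2 ^ m) by rw [hq8]; ring, card_eq_sum_ones,
        sum_filter_dvd_range_mul two_pos, sum_const, card_range, smul_eq_mul, mul_one]
    rw [card_range, h2, hq8] at h1
    omega
  have hCcard : #C = 2 ^ m := by
    have himg : C = (range (2 ^ m)).image (fun k => 8 * k + 1) := by
      ext r
      simp only [hC, mem_filter, mem_range, mem_image]
      constructor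
      · rintro ⟨hr, hr8⟩
        rw [hq8] at hr
        exact ⟨r / 8, by omega, by omega⟩
      · rintro ⟨k, hk, rfl⟩
        rw [hq8]
        exact ⟨by omega, by omega⟩
    rw [himg, card_image_of_injective _ (fun k₁ k₂ h => by simpa using h), card_range]
  -- the squaring map `U → C`
  have hmap : ∀ y ∈ U, y ^ 2 % q ∈ C := by
    intro y hy
    rw [hU, mem_filter] at hy
    rw [hC, mem_filter, mem_range]
    refine ⟨Nat.mod_lt _ hq0, ?_⟩
    rw [Nat.mod_mod_of_dvd _ hq8', Nat.pow_mod]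
    have : y % 8 = 1 ∨ y % 8 = 3 ∨ y % 8 = 5 ∨ y % 8 = 7 := by omega
    rcases this with h | h | h | h <;> rw [h]
  -- each fibre lies in a set of square roots, so has at most four elements
  have hfib_sub : ∀ r : ℕ, U.filter (fun y => y ^ 2 % q = r) ⊆ sqrtSet 2 (m + 3) (r : ℤ) := by
    intro r y hy
    rw [mem_filter, hU, mem_filter] at hy
    obtain ⟨⟨hyq, -⟩, hyr⟩ := hy
    rw [sqrtSet, mem_filter]
    refine ⟨hyq, (y : ℤ) ^ 2 / (q : ℤ), ?_⟩
    have h := Nat.div_add_mod (y ^ 2) q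
    rw [hyr] at h
    have h' : ((q * (y ^ 2 / q) + r : ℕ) : ℤ) = ((y ^ 2 : ℕ) : ℤ) := by rw [h]
    push_cast at h'
    linear_combination -h'
  have hfib_le : ∀ r ∈ C, #(U.filter (fun y => y ^ 2 % q = r)) ≤ 4 := by
    intro r hr
    rw [hC, mem_filter] at hr
    have hr2 : ¬ ((2 : ℕ) : ℤ) ∣ (r : ℤ) := by omega
    exact (card_le_card (hfib_sub r)).trans (card_sqrtSet_le_four Nat.prime_two (m + 3) hr2)
  -- so each fibre has exactly four elements
  have hsum : ∑ r ∈ C, #(U.filter (fun y => y ^ 2 % q = r)) = ∑ r ∈ C, 4 := by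
    rw [← card_eq_sum_card_fiberwise hmap, hUcard, sum_const, hCcard, smul_eq_mul, mul_comm]
  have hfib_eq : ∀ r ∈ C, #(U.filter (fun y => y ^ 2 % q = r)) = 4 :=
    (sum_eq_sum_iff_of_le hfib_le).mp hsum
  -- the class of `c`
  set r₀ : ℕ := (c % (q : ℤ)).toNat with hr₀
  have hqZ : (0 : ℤ) < q := by exact_mod_cast hq0
  have hcq : (r₀ : ℤ) = c % (q : ℤ) := by
    rw [hr₀, Int.toNat_of_nonneg (Int.emod_nonneg _ hqZ.ne')]
  have hr₀C : r₀ ∈ C := by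
    rw [hC, mem_filter, mem_range]
    constructor
    · have : (r₀ : ℤ) < q := by rw [hcq]; exact Int.emod_lt_of_pos _ hqZ
      exact_mod_cast this
    · have h8 : (r₀ : ℤ) % 8 = 1 := by
        rw [hcq, Int.emod_emod_of_dvd _ (by exact_mod_cast hq8'), hc]
      omega
  have hdvd : (q : ℤ) ∣ c - r₀ := by
    rw [hcq]
    exact (Int.mod_modEq c q).dvd
  have hset : sqrtSet 2 (m + 3) c = sqrtSet 2 (m + 3) (r₀ : ℤ) := by
    unfold sqrtSet
    refine filter_congr fun y _ => ?_
    constructor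
    · intro h
      have e : (y : ℤ) ^ 2 - r₀ = ((y : ℤ) ^ 2 - c) + (c - r₀) := by ring
      rw [e]
      exact dvd_add h hdvd
    · intro h
      have e : (y : ℤ) ^ 2 - c = ((y : ℤ) ^ 2 - r₀) - (c - r₀) := by ring
      rw [e]
      exact dvd_sub h hdvd
  rw [hset]
  refine le_antisymm (card_sqrtSet_le_four Nat.prime_two _ ?_) ?_
  · have := (mem_filter.mp hr₀C).2
    omega
  · calc 4 = #(U.filter (fun y => y ^ 2 % q = r₀)) := (hfib_eq r₀ hr₀C).symm
      _ ≤ #(sqrtSet 2 (m + 3) (r₀ : ℤ)) := card_le_card (hfib_sub r₀)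

/-- **Lemma 8.2, (8.11).** "For `p = 2`, `ν ≥ 1`, `a ≡ 1 (mod 8)` we have `2^{-ν} N(a; 2^ν) = ν`."
[cite: FriedlanderIwaniecAnnals1998, Lemma 8.2, (8.11)] -/
theorem quadCongrCount_two_pow {a : ℤ} (ha : a % 8 = 1) {ν : ℕ} (hν : 0 < ν) :
    quadCongrCount (2 ^ ν) a 1 = ν * 2 ^ ν := by
  have ha2 : ¬ ((2 : ℕ) : ℤ) ∣ a := by omega
  obtain ⟨k, rfl⟩ : ∃ k, ν = k + 1 := ⟨ν - 1, by omega⟩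
  clear hν
  induction k using Nat.twoStepInduction with
  | zero =>
    rw [quadCongrCount_prime Nat.prime_two ha2, card_sqrtSet_two_one ha]
    decide
  | one =>
    rw [quadCongrCount_prime_pow_add_two Nat.prime_two ha2 0, card_sqrtSet_two_two ha, pow_zero,
      quadCongrCount_mod_one]
    decide
  | more k ih _ =>
    rw [show k + 2 + 1 = (k + 1) + 2 by ring, quadCongrCount_prime_pow_add_two Nat.prime_two ha2 (k + 1),
      ih, card_sqrtSet_two_pow ha (by omega), Nat.totient_prime_pow_succ Nat.prime_two]
    ring

/-! ### Corollary 8.3 -/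

/-- Sum over the divisors of a coprime product. [folklore] -/
private theorem sum_divisors_mul_of_coprime {β : Type*} [AddCommMonoid β] {m n : ℕ}
    (hmn : m.Coprime n) (f : ℕ → β) :
    ∑ k ∈ (m * n).divisors, f k = ∑ a ∈ m.divisors, ∑ b ∈ n.divisors, f (a * b) := by
  rw [Nat.divisors_mul, Finset.mul_def, Finset.sum_image hmn.mul_injOn_divisors, Finset.sum_product]

/-- **Corollary 8.3.** "For `q` odd and `(a, q) = 1` we have (8.13)
`N(a; q) = q Σ_{d ∣ q} φ(d)/d (a/d)`" — in integers: `N(a; q) = Σ_{d ∣ q} (q/d) φ(d) (a/d)`.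
[cite: FriedlanderIwaniecAnnals1998, Corollary 8.3, (8.13)] -/
theorem quadCongrCount_eq_sum_divisors {q : ℕ} (hq : 0 < q) (hodd : Odd q) {a : ℤ}
    (ha : IsCoprime a (q : ℤ)) :
    (quadCongrCount q a 1 : ℤ) = ∑ d ∈ q.divisors, ((q / d : ℕ) : ℤ) * (d.totient : ℤ) * J(a | d) := by
  induction q using Nat.recOnPosPrimePosCoprime with
  | zero => exact absurd hq (lt_irrefl 0)
  | one => simp [quadCongrCount_mod_one]
  | prime_pow p k hp hk =>
    have hpa : ¬ (p : ℤ) ∣ a := by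
      intro hpa
      have h1 : (p : ℤ) ∣ ((p ^ k : ℕ) : ℤ) := by exact_mod_cast dvd_pow_self p hk.ne'
      have hu := ha.isUnit_of_dvd' hpa h1
      rw [Int.isUnit_iff_natAbs_eq, Int.natAbs_natCast] at hu
      exact hp.one_lt.ne' hu
    have hp2 : p ≠ 2 := by
      rintro rfl
      have h2 : Odd 2 := hodd.of_dvd_nat (dvd_pow_self 2 hk.ne')
      exact (Nat.not_even_iff_odd.mpr h2) even_two
    exact quadCongrCount_odd_prime_pow_eq_sum_divisors hp hp2 hpa k
  | coprime m n hm hn hmn ihm ihn =>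
    have hm0 : 0 < m := by omega
    have hn0 : 0 < n := by omega
    have ham : IsCoprime a (m : ℤ) := by
      have : IsCoprime a ((m : ℤ) * n) := by exact_mod_cast ha
      exact this.of_mul_right_left
    have han : IsCoprime a (n : ℤ) := by
      have : IsCoprime a ((m : ℤ) * n) := by exact_mod_cast ha
      exact this.of_mul_right_right
    have hmodd : Odd m := hodd.of_dvd_nat (dvd_mul_right m n)
    have hnodd : Odd n := hodd.of_dvd_nat (dvd_mul_left n m)
    rw [quadCongrCount_mul_of_coprime hm0 hn0 hmn, Nat.cast_mul, ihm hm0 hmodd ham, ihn hn0 hnodd han,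
      sum_divisors_mul_of_coprime hmn, sum_mul_sum]
    refine sum_congr rfl fun d₁ hd₁ => sum_congr rfl fun d₂ hd₂ => ?_
    have hd₁m : d₁ ∣ m := Nat.dvd_of_mem_divisors hd₁
    have hd₂n : d₂ ∣ n := Nat.dvd_of_mem_divisors hd₂
    have hd₁0 : d₁ ≠ 0 := (Nat.pos_of_mem_divisors hd₁).ne'
    have hd₂0 : d₂ ≠ 0 := (Nat.pos_of_mem_divisors hd₂).ne'
    have hcop : d₁.Coprime d₂ :=
      Nat.Coprime.coprime_dvd_left hd₁m (Nat.Coprime.coprime_dvd_right hd₂n hmn)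
    rw [← Nat.div_mul_div_comm hd₁m hd₂n, Nat.totient_mul hcop, jacobiSym.mul_right' a hd₁0 hd₂0]
    push_cast
    ring

/-! ### (8.9) with (8.11) and (8.13): the count to an even modulus -/

/-- For `n = 2^ν n'` with `n'` odd, `ν ≥ 1`, `a ≡ 1 (mod 8)`, `(a, n) = 1`:
`N(a; n) = ν 2^ν · Σ_{d ∣ n'} (n'/d) φ(d) (a/d)` — (8.9) evaluated by (8.11) at `p = 2` and by (8.13)
at the odd part. [cite: FriedlanderIwaniecAnnals1998, (8.9), (8.11), (8.13)] -/
theorem quadCongrCount_even {n : ℕ} (hn : n ≠ 0) (h2 : 2 ∣ n) {a : ℤ} (ha8 : a % 8 = 1)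
    (ha : IsCoprime a (n : ℤ)) :
    (quadCongrCount n a 1 : ℤ) = n.factorization 2 * 2 ^ n.factorization 2 *
      ∑ d ∈ (ordCompl[2] n).divisors, ((ordCompl[2] n / d : ℕ) : ℤ) * (d.totient : ℤ) * J(a | d) := by
  set ν := n.factorization 2 with hν
  set n' := ordCompl[2] n with hn'
  have hdec : 2 ^ ν * n' = n := Nat.ordProj_mul_ordCompl_eq_self n 2
  have hn'0 : 0 < n' := Nat.ordCompl_pos 2 hn
  have hcop : Nat.Coprime (2 ^ ν) n' := (Nat.coprime_ordCompl Nat.prime_two hn).pow_left ν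
  have hν1 : 0 < ν := (Nat.prime_two.pow_dvd_iff_le_factorization hn).mp (by rwa [pow_one])
  have hodd : Odd n' :=
    Nat.odd_iff.mpr (Nat.two_dvd_ne_zero.mp (Nat.not_dvd_ordCompl Nat.prime_two hn))
  have ha' : IsCoprime a (n' : ℤ) := by
    have : IsCoprime a (((2 ^ ν : ℕ) : ℤ) * n') := by rw [← hdec] at ha; exact_mod_cast ha
    exact this.of_mul_right_right
  conv_lhs => rw [← hdec]
  rw [quadCongrCount_mul_of_coprime (pow_pos two_pos ν) hn'0 hcop, Nat.cast_mul,
    quadCongrCount_two_pow ha8 hν1, quadCongrCount_eq_sum_divisors hn'0 hodd ha']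
  push_cast
  ring

/-- `Σ_{0 ≤ i ≤ k} φ(2^i)/2^i = 1 + k/2`. [folklore] -/
private theorem sum_totient_two_pow_div (k : ℕ) :
    ∑ i ∈ range (k + 1), (((2 ^ i).totient : ℕ) : ℚ) / (2 : ℚ) ^ i = 1 + k / 2 := by
  induction k with
  | zero => simp
  | succ k ih =>
    rw [sum_range_succ, ih, Nat.totient_prime_pow_succ Nat.prime_two]
    push_cast
    field_simp
    ring

/-- **The passage (8.14) → (8.16)** as an identity of divisor sums: for `4 ∣ n`, `n = 2^ν n'`, `n'` odd,
`2 Σ_{d ∣ n/4} φ(d)/d (a/d') = ν Σ_{d ∣ n'} φ(d)/d (a/d)` with `d'` the odd part of `d` (convention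
(8.15)): `Σ_{j ≤ ν-2} φ(2^j)/2^j = ν/2`. [cite: FriedlanderIwaniecAnnals1998, (8.14)-(8.16)] -/
theorem two_mul_sum_divisors_div_four {n : ℕ} (hn : n ≠ 0) (h4 : 4 ∣ n) (a : ℤ) :
    2 * ∑ d ∈ (n / 4).divisors, ((d.totient : ℚ) / d) * J(a | ordCompl[2] d) =
      n.factorization 2 * ∑ d ∈ (ordCompl[2] n).divisors, ((d.totient : ℚ) / d) * J(a | d) := by
  set ν := n.factorization 2 with hν
  set n' := ordCompl[2] n with hn'
  have hdec : 2 ^ ν * n' = n := Nat.ordProj_mul_ordCompl_eq_self n 2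
  have hν2 : 2 ≤ ν := (Nat.prime_two.pow_dvd_iff_le_factorization hn).mp (by norm_num; exact h4)
  obtain ⟨j, hj⟩ : ∃ j, ν = j + 2 := ⟨ν - 2, by omega⟩
  have hn4 : n / 4 = 2 ^ j * n' := by
    rw [← hdec, hj, show 2 ^ (j + 2) * n' = 4 * (2 ^ j * n') by ring,
      Nat.mul_div_cancel_left _ (by norm_num : 0 < 4)]
  have hcopj : Nat.Coprime (2 ^ j) n' := (Nat.coprime_ordCompl Nat.prime_two hn).pow_left j
  have hodd : ¬ 2 ∣ n' := Nat.not_dvd_ordCompl Nat.prime_two hn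
  rw [hn4, sum_divisors_mul_of_coprime hcopj, Nat.sum_divisors_prime_pow Nat.prime_two]
  -- factor each term
  have hterm : ∀ i ∈ range (j + 1), ∀ d₂ ∈ n'.divisors,
      (((2 ^ i * d₂).totient : ℚ) / ((2 ^ i * d₂ : ℕ) : ℚ)) * J(a | ordCompl[2] (2 ^ i * d₂)) =
        ((((2 ^ i).totient : ℕ) : ℚ) / (2 : ℚ) ^ i) * (((d₂.totient : ℚ) / d₂) * J(a | d₂)) := by
    intro i _ d₂ hd₂
    have hd₂n : d₂ ∣ n' := Nat.dvd_of_mem_divisors hd₂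
    have hd₂odd : ¬ 2 ∣ d₂ := fun h => hodd (h.trans hd₂n)
    have hcop : Nat.Coprime (2 ^ i) d₂ := Nat.Coprime.coprime_dvd_right hd₂n
      ((Nat.coprime_ordCompl Nat.prime_two hn).pow_left i)
    rw [Nat.totient_mul hcop, Nat.ordCompl_mul, Nat.ordCompl_self_pow Nat.prime_two, one_mul,
      (Nat.ordCompl_eq_self_iff_zero_or_not_dvd d₂ Nat.prime_two).mpr (Or.inr hd₂odd)]
    push_cast
    ring
  rw [sum_congr rfl fun i hi => sum_congr rfl fun d₂ hd₂ => hterm i hi d₂ hd₂, ← sum_mul_sum,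
    sum_totient_two_pow_div, hj]
  push_cast
  ring

/-! ### (8.14) and Lemma 8.4: the exact formula for `G₀(z₁, z₂)` -/

section GZero

variable {z₁ z₂ : ℤ × ℤ} {a : ℤ}

/-- `|Δ| G₀(z₁, z₂) = N(a; |Δ|) = N(a, 1; |Δ|)` for the rational class `a` of `z₂/z₁ (mod Δ)` ((6.6),
(6.12), (8.8)). [cite: FriedlanderIwaniecAnnals1998, (8.8)] -/
theorem gCount_eq_quadCongrCount
    (ha : det2 z₁ z₂ ∣ z₂.1 - a * z₁.1 ∧ det2 z₁ z₂ ∣ z₂.2 - a * z₁.2)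
    (h1 : IsCoprime (det2 z₁ z₂) (z₁.1 ^ 2 + z₁.2 ^ 2)) :
    gCount z₁ z₂ = quadCongrCount (det2 z₁ z₂).natAbs a 1 := by
  rw [gCount_eq ha h1, quadCongrCount_one_right]

/-- **(8.14), integer form**: `|Δ| G₀(z₁,z₂) = ν 2^ν Σ_{d ∣ Δ'} (Δ'/d) φ(d) ((z₂/z₁)/d)`, `Δ = 2^ν Δ'`,
`Δ'` odd, for `Δ` even, `(Δ, |z₁|²) = (Δ, |z₂|²) = 1` and `z₂/z₁ ≡ a ≡ 1 (mod 8)`.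
[cite: FriedlanderIwaniecAnnals1998, (8.9), (8.14)] -/
theorem gCount_eq_ord_two_mul_sum (hΔ : det2 z₁ z₂ ≠ 0)
    (ha : det2 z₁ z₂ ∣ z₂.1 - a * z₁.1 ∧ det2 z₁ z₂ ∣ z₂.2 - a * z₁.2)
    (h1 : IsCoprime (det2 z₁ z₂) (z₁.1 ^ 2 + z₁.2 ^ 2))
    (h2 : IsCoprime (det2 z₁ z₂) (z₂.1 ^ 2 + z₂.2 ^ 2))
    (h2Δ : (2 : ℤ) ∣ det2 z₁ z₂) (ha8 : a % 8 = 1) :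
    (gCount z₁ z₂ : ℤ) =
      (det2 z₁ z₂).natAbs.factorization 2 * 2 ^ (det2 z₁ z₂).natAbs.factorization 2 *
        ∑ d ∈ (ordCompl[2] (det2 z₁ z₂).natAbs).divisors,
          ((ordCompl[2] (det2 z₁ z₂).natAbs / d : ℕ) : ℤ) * (d.totient : ℤ) * J(a | d) := by
  have hcop : IsCoprime a (((det2 z₁ z₂).natAbs : ℕ) : ℤ) := by
    rw [Int.natCast_natAbs]
    exact (isCoprime_ratio ha h2).abs_right
  have h2' : 2 ∣ (det2 z₁ z₂).natAbs := Int.natCast_dvd.mp (by exact_mod_cast h2Δ)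
  rw [gCount_eq_quadCongrCount ha h1]
  exact quadCongrCount_even (Int.natAbs_ne_zero.mpr hΔ) h2' ha8 hcop

/-- **(8.14)**: "`G₀(z₁, z₂) = ν Σ_{d ∣ Δ, d odd} φ(d)/d ((z₂/z₁)/d)` where `ν` is the order of `2` in
`Δ`, that is `Δ = 2^ν Δ'` with `Δ'` odd" — as `|Δ| G₀ = |Δ| · ν Σ_{d ∣ Δ'} φ(d)/d (a/d)` for the
rational class `a ≡ z₂/z₁ (mod Δ)` with `a ≡ 1 (mod 8)` ("Note that `z₂/z₁ ≡ 1 (mod 8)` due to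
(5.7)"). [cite: FriedlanderIwaniecAnnals1998, (8.14)] -/
theorem gCount_eq_natAbs_mul_ord_mul_sum (hΔ : det2 z₁ z₂ ≠ 0)
    (ha : det2 z₁ z₂ ∣ z₂.1 - a * z₁.1 ∧ det2 z₁ z₂ ∣ z₂.2 - a * z₁.2)
    (h1 : IsCoprime (det2 z₁ z₂) (z₁.1 ^ 2 + z₁.2 ^ 2))
    (h2 : IsCoprime (det2 z₁ z₂) (z₂.1 ^ 2 + z₂.2 ^ 2))
    (h2Δ : (2 : ℤ) ∣ det2 z₁ z₂) (ha8 : a % 8 = 1) :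
    (gCount z₁ z₂ : ℚ) = (det2 z₁ z₂).natAbs *
      ((det2 z₁ z₂).natAbs.factorization 2 *
        ∑ d ∈ (ordCompl[2] (det2 z₁ z₂).natAbs).divisors, ((d.totient : ℚ) / d) * J(a | d)) := by
  have hZ := gCount_eq_ord_two_mul_sum hΔ ha h1 h2 h2Δ ha8
  set n := (det2 z₁ z₂).natAbs with hn
  have hQ := congrArg (Int.cast : ℤ → ℚ) hZ
  simp only [Int.cast_mul, Int.cast_sum, Int.cast_natCast, Int.cast_pow, Int.cast_ofNat] at hQ
  have hdec : (n : ℚ) = ((2 : ℚ) ^ n.factorization 2) * (ordCompl[2] n : ℕ) := by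
    exact_mod_cast (Nat.ordProj_mul_ordCompl_eq_self n 2).symm
  rw [hQ, hdec]
  simp only [mul_sum]
  refine sum_congr rfl fun d hd => ?_
  have hdn : d ∣ ordCompl[2] n := Nat.dvd_of_mem_divisors hd
  have hd0 : (d : ℚ) ≠ 0 := by exact_mod_cast (Nat.pos_of_mem_divisors hd).ne'
  rw [Nat.cast_div hdn hd0]
  field_simp

/-- **LEMMA 8.4 ((8.16))**: "`G₀(z₁, z₂) = 2 Σ_{4d ∣ Δ} φ(d)/d ((z₂/z₁)/d)`" with the convention (8.15)
`(a/d) = (a/d')`, `d'` the odd part of `d` — stated as `|Δ| G₀ = |Δ| · 2 Σ_{d ∣ |Δ|/4} φ(d)/d (a/d')`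
(`4d ∣ Δ ⟺ d ∣ |Δ|/4`) for the rational class `a ≡ z₂/z₁ (mod Δ)`, `a ≡ 1 (mod 8)`, `4 ∣ Δ`,
`(Δ, |z₁|²) = (Δ, |z₂|²) = 1`. [cite: FriedlanderIwaniecAnnals1998, Lemma 8.4, (8.16)] -/
theorem gCount_eq_natAbs_mul_two_mul_sum (hΔ : det2 z₁ z₂ ≠ 0)
    (ha : det2 z₁ z₂ ∣ z₂.1 - a * z₁.1 ∧ det2 z₁ z₂ ∣ z₂.2 - a * z₁.2)
    (h1 : IsCoprime (det2 z₁ z₂) (z₁.1 ^ 2 + z₁.2 ^ 2))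
    (h2 : IsCoprime (det2 z₁ z₂) (z₂.1 ^ 2 + z₂.2 ^ 2))
    (h4Δ : (4 : ℤ) ∣ det2 z₁ z₂) (ha8 : a % 8 = 1) :
    (gCount z₁ z₂ : ℚ) = (det2 z₁ z₂).natAbs *
      (2 * ∑ d ∈ ((det2 z₁ z₂).natAbs / 4).divisors, ((d.totient : ℚ) / d) * J(a | ordCompl[2] d)) := by
  have h4 : 4 ∣ (det2 z₁ z₂).natAbs := Int.natCast_dvd.mp (by exact_mod_cast h4Δ)
  have h2Δ : (2 : ℤ) ∣ det2 z₁ z₂ := (show (2 : ℤ) ∣ 4 by norm_num).trans h4Δ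
  rw [two_mul_sum_divisors_div_four (Int.natAbs_ne_zero.mpr hΔ) h4 a]
  exact gCount_eq_natAbs_mul_ord_mul_sum hΔ ha h1 h2 h2Δ ha8

/-- **Lemma 8.4 under its printed hypotheses**: "Suppose that `(z₁, z₂) = (z₁, z̄₁) = (z₂, z̄₂) = 1`
and also `z₁ ≡ z₂ (mod 8)`. Then … (8.16)". Here `(Δ, |z₁|²) = (Δ, |z₂|²) = 1` ((6.6), from the
three coprimality conditions), `z₁ ≡ z₂ (mod 8)` componentwise and `r₁ = Re z₁` odd (`z₁` primary):
then `8 ∣ Δ` and the rational class `a ≡ z₂/z₁ (mod Δ)` is `≡ 1 (mod 8)`, so (8.16) holds.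
[cite: FriedlanderIwaniecAnnals1998, Lemma 8.4, (8.16)] -/
theorem gCount_eq_natAbs_mul_two_mul_sum_of_congr_eight (hΔ : det2 z₁ z₂ ≠ 0)
    (ha : det2 z₁ z₂ ∣ z₂.1 - a * z₁.1 ∧ det2 z₁ z₂ ∣ z₂.2 - a * z₁.2)
    (h1 : IsCoprime (det2 z₁ z₂) (z₁.1 ^ 2 + z₁.2 ^ 2))
    (h2 : IsCoprime (det2 z₁ z₂) (z₂.1 ^ 2 + z₂.2 ^ 2))
    (h8 : (8 : ℤ) ∣ z₂.1 - z₁.1 ∧ (8 : ℤ) ∣ z₂.2 - z₁.2) (hodd : Odd z₁.1) :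
    (8 : ℤ) ∣ det2 z₁ z₂ ∧ a % 8 = 1 ∧
    (gCount z₁ z₂ : ℚ) = (det2 z₁ z₂).natAbs *
      (2 * ∑ d ∈ ((det2 z₁ z₂).natAbs / 4).divisors, ((d.totient : ℚ) / d) * J(a | ordCompl[2] d)) := by
  have h8Δ : (8 : ℤ) ∣ det2 z₁ z₂ := by
    have e : det2 z₁ z₂ = z₁.1 * (z₂.2 - z₁.2) - (z₂.1 - z₁.1) * z₁.2 := by rw [det2]; ring
    rw [e]
    exact dvd_sub (dvd_mul_of_dvd_right h8.2 _) (dvd_mul_of_dvd_left h8.1 _)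
  have ha8 : a % 8 = 1 := by
    have h3 : (8 : ℤ) ∣ (a - 1) * z₁.1 := by
      have e : (a - 1) * z₁.1 = (z₂.1 - z₁.1) - (z₂.1 - a * z₁.1) := by ring
      rw [e]
      exact dvd_sub h8.1 (h8Δ.trans ha.1)
    have hc2 : IsCoprime (2 : ℤ) z₁.1 := Int.prime_two.coprime_iff_not_dvd.mpr (by
      obtain ⟨k, hk⟩ := hodd; omega)
    have hc8 : IsCoprime (8 : ℤ) z₁.1 := by
      have := hc2.pow_left (m := 3)
      norm_num at this
      exact this
    have h4 : (8 : ℤ) ∣ a - 1 := hc8.dvd_of_dvd_mul_right h3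
    omega
  exact ⟨h8Δ, ha8, gCount_eq_natAbs_mul_two_mul_sum hΔ ha h1 h2
    ((show (4 : ℤ) ∣ 8 by norm_num).trans h8Δ) ha8⟩

/-- The symbol in (8.16) depends on the class `a (mod 4d)` only: any `ω ≡ a (mod 4d)` — e.g. the
class of `z₂/z₁` modulo `4d` rather than modulo `Δ` — gives the same `(ω/d')`.
[cite: FriedlanderIwaniecAnnals1998, (8.15)-(8.16), (10.2)] -/
theorem jacobiSym_ordCompl_eq_of_dvd_sub {ω : ℤ} {d : ℕ} (h : (4 * d : ℤ) ∣ ω - a) :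
    J(ω | ordCompl[2] d) = J(a | ordCompl[2] d) := by
  apply jacobiSym.mod_left'
  have hd : ((ordCompl[2] d : ℕ) : ℤ) ∣ (4 * d : ℤ) :=
    (Int.natCast_dvd_natCast.mpr (Nat.ordCompl_dvd d 2)).trans
      (by exact_mod_cast dvd_mul_left d 4)
  have h' : ((ordCompl[2] d : ℕ) : ℤ) ∣ a - ω := hd.trans (by rw [← neg_sub]; exact (dvd_neg).mpr h)
  exact Int.modEq_iff_dvd.mpr h'

end GZero

end Literature.NumberTheory.Sieve.FriedlanderIwaniecPrimes
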